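import Summits.CriticalPhenomena.PercolationContinuityZ3.Theorems.Transplant.SkelNegParamsFineA
import Summits.CriticalPhenomena.PercolationContinuityZ3.Theorems.Transplant.SkelPhiCellsWeakGQ
import HarnessLib

/-!
# Quasi-step rung (N3-b), BINDER WAVE, row «SkelNegParamsFineA» of WAVE-Q-MANIFEST v0.5 (rows TSV) under (ι) := `Skelφ.QStepsN G φ M`: THE FINE MAP `fineA` HAS
# WEAK STEPS from exact-footprint quasi-steps of `φ` — the twin of «SkelNegParamsFineA» `NegPrm.weakSteps_fineA` (which assumed `Steps G φ`)

builds on p205010 (kernel theorem, internal audit signed; external expert review pending) — nothing in this file uses p205010; nothing here is a claim about any open node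
((N3-b), the end state); no carrier, no node, no definition.  Lane `prim-bschramm`, seat `prim-hp-8` (gen 62; binder-wave pen, pilot family P1 — lane INBOX 2026-08-27 07:25Z).
Helper file (`--supports stmt-CriticalPhenomena-4575 --as helper`).
WHY (hunk class (i) binder + the β4 call-site swap, no radius).  The tree file takes `hstep : Steps G φ` only to call `weakSteps_fineSkel`; under the rung's currency the call is
gen-1 g4's `weakSteps_fineSkel_of_qStepsN` («SkelPhiCellsWeakGQ», p506284: the FIRST EDGE of the realising link is non-retreating), so the binder becomes
`{M} (hq : QStepsN G φ M)` and nothing else changes (weak steps are single edges: no cost, no floor).  Its three readers («SkelFrmFromBParamsLFA» :235 and the Neg/Frm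
twins) swap `weakSteps_fineA hstep ↦ weakSteps_fineA_q hq` in the binder wave.  Regression: `qStepsN_of_steps`, `M = 1`.
* **`NegPrm.weakSteps_fineA_q`**.
[cite: KozmaNitzan2024, §4 Lemma 10 Step III (p. 19), Step IV (pp. 20–21)] [cite: MartineauTassion2017, §4.3]
-/

noncomputable section

namespace Summit.CriticalPhenomena.PercolationContinuityZ3.Theorems.Transplant

namespace Skelφ

namespace NegPrm

open Literature.Probability.LatticeModels
open TwoAxis.Para (lam0 lam1)

variable {V : Type} {G : SimpleGraph V}

/-- **THE FINE MAP HAS WEAK STEPS** from exact-footprint quasi-steps of `φ` alone (`A ≠ 0`, `1 ≤ n`, `1 ≤ ℓ`; any cost `M`) — the twin of `weakSteps_fineA` with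
`hstep : Steps G φ ↦ hq : QStepsN G φ M`. [this work] -/
theorem weakSteps_fineA_q {φ : V → Site 2} {M : ℕ} (hq : QStepsN G φ M) (t : V) {A : ℤ} (hA : A ≠ 0) (P : PCells2) {n ℓ : ℕ} (hn : 1 ≤ n)
    (hℓ : 1 ≤ ℓ) (h vα : ℤ) : WeakSteps G (fineA φ t A P n h ℓ vα) := by
  rw [fineA_eq]
  exact weakSteps_fineSkel_of_qStepsN hq t (DofA_pos hA hn hℓ h vα) (c_nonneg P 0) (c_nonneg P 1)

end NegPrm

end Skelφ

end Summit.CriticalPhenomena.PercolationContinuityZ3.Theorems.Transplant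

end
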